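import Summits.CriticalPhenomena.PercolationContinuityZ3.Theorems.SahiBoxTP2Split
import Mathlib.Probability.ProductMeasure

/-!
# Box-TP₂ laws on `ℕ → X`: initial-segment marginals, the marginal criterion, projective uniqueness

Support file of the Sahi cell (`prim-sahi`, typer seat, generation 12; `--supports stmt-CriticalPhenomena-4575`).
First half of the coupling theorem on the Hilbert cube (`SahiBoxTP2HilbertCoupling.lean`): the bookkeeping of a
probability measure on a sequence space `ℕ → X` through its initial-segment marginals `μ ∘ (finRestrict d)⁻¹` on
`Fin d → X`.

* `finRestrict d u = (u_0,…,u_{d-1})`, `finExtend` (fill the free coordinates with a constant); a box of `Q_d` pulls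
  back to a box of the Hilbert cube (`finRestrict_preimage_Icc`), so **box-TP₂ passes to every marginal**
  (`IsBoxTP2.map_finRestrict`), and conversely **box-TP₂ of all marginals gives box-TP₂** by continuity from above
  (`isBoxTP2_iff_forall_map_finRestrict`: "all finite-dimensional distributions are box-TP₂ / MTP₂").
* Consistency with the split of the last coordinate of `SahiBoxTP2Split.lean` (`initLast_finRestrict_succ`,
  `fst_map_initLast_map_finRestrict_succ`).
* **Two finite measures on `ℕ → X` with the same initial-segment marginals are equal** (`ext_of_map_finRestrict`,
  Mathlib's uniqueness of projective limits), and the marginals of `λ^ℕ = Measure.infinitePi (fun _ => volume)`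
  (`lebesgueHilbert`) are the Lebesgue measures `λ_d` (`infinitePi_map_finRestrict`).

No sorries, no new axioms.
-/

noncomputable section

namespace Summit.CriticalPhenomena.PercolationContinuityZ3.Theorems.SahiBoxTP2

open MeasureTheory ProbabilityTheory Set Filter Topology Function
open scoped ENNReal unitInterval

/-! ### Initial segments of a sequence -/

section FinRestrict

variable {X : Type*}

/-- The first `d` terms of a sequence: `finRestrict d u = (u 0, …, u (d-1))`. -/
def finRestrict (d : ℕ) (u : ℕ → X) : Fin d → X := fun i => u i

/-- `finRestrict d u i = u i`. [folklore] -/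
@[simp] theorem finRestrict_apply (d : ℕ) (u : ℕ → X) (i : Fin d) : finRestrict d u i = u i := rfl

/-- `finRestrict d` is measurable. [folklore] -/
@[fun_prop]
theorem measurable_finRestrict [MeasurableSpace X] (d : ℕ) : Measurable (finRestrict (X := X) d) :=
  measurable_pi_lambda _ fun i => measurable_pi_apply (i : ℕ)

/-- `finRestrict d` is monotone. [folklore] -/
theorem finRestrict_mono [Preorder X] (d : ℕ) : Monotone (finRestrict (X := X) d) := fun _ _ h i => h i

/-- Extension of a `d`-tuple to a sequence by a constant `c`. -/
def finExtend (d : ℕ) (a : Fin d → X) (c : X) : ℕ → X := fun i => if h : i < d then a ⟨i, h⟩ else c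

/-- On the first `d` indices `finExtend` returns the tuple. [folklore] -/
theorem finExtend_of_lt {d : ℕ} (a : Fin d → X) (c : X) {i : ℕ} (hi : i < d) :
    finExtend d a c i = a ⟨i, hi⟩ := by
  simp only [finExtend, dif_pos hi]

/-- Beyond the first `d` indices `finExtend` returns the constant. [folklore] -/
theorem finExtend_of_le {d : ℕ} (a : Fin d → X) (c : X) {i : ℕ} (hi : d ≤ i) :
    finExtend d a c i = c := by
  simp only [finExtend, dif_neg (not_lt.2 hi)]

/-- `finRestrict ∘ finExtend = id`. [folklore] -/
@[simp] theorem finRestrict_finExtend {d : ℕ} (a : Fin d → X) (c : X) : finRestrict d (finExtend d a c) = a := by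
  funext i
  simp only [finRestrict_apply, finExtend_of_lt a c i.2]

/-- `finExtend` commutes with binary meets (constant `⊓` constant). [folklore] -/
theorem finExtend_inf [Lattice X] {d : ℕ} (a a' : Fin d → X) (c : X) :
    finExtend d (a ⊓ a') c = finExtend d a c ⊓ finExtend d a' c := by
  funext i
  by_cases hi : i < d
  · simp only [Pi.inf_apply, finExtend_of_lt _ _ hi]
  · simp only [Pi.inf_apply, finExtend_of_le _ _ (not_lt.1 hi), inf_idem]

/-- `finExtend` commutes with binary joins. [folklore] -/
theorem finExtend_sup [Lattice X] {d : ℕ} (a a' : Fin d → X) (c : X) :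
    finExtend d (a ⊔ a') c = finExtend d a c ⊔ finExtend d a' c := by
  funext i
  by_cases hi : i < d
  · simp only [Pi.sup_apply, finExtend_of_lt _ _ hi]
  · simp only [Pi.sup_apply, finExtend_of_le _ _ (not_lt.1 hi), sup_idem]

/-- **A box of `Q_d` pulls back to a box of the Hilbert cube** (free coordinates filled with `⊥`, `⊤`). [folklore] -/
theorem finRestrict_preimage_Icc [Preorder X] [OrderBot X] [OrderTop X] {d : ℕ} (a b : Fin d → X) :
    finRestrict d ⁻¹' Icc a b = Icc (finExtend d a ⊥) (finExtend d b ⊤) := by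
  ext u
  simp only [mem_preimage, mem_Icc, Pi.le_def, finRestrict_apply]
  constructor
  · rintro ⟨h1, h2⟩
    refine ⟨fun i => ?_, fun i => ?_⟩
    · by_cases hi : i < d
      · rw [finExtend_of_lt _ _ hi]; exact h1 ⟨i, hi⟩
      · rw [finExtend_of_le _ _ (not_lt.1 hi)]; exact bot_le
    · by_cases hi : i < d
      · rw [finExtend_of_lt _ _ hi]; exact h2 ⟨i, hi⟩
      · rw [finExtend_of_le _ _ (not_lt.1 hi)]; exact le_top
  · rintro ⟨h1, h2⟩
    refine ⟨fun i => ?_, fun i => ?_⟩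
    · have := h1 i; rwa [finExtend_of_lt _ _ i.2] at this
    · have := h2 i; rwa [finExtend_of_lt _ _ i.2] at this

/-- **Box-TP₂ passes to every initial-segment marginal.** [this work] -/
theorem IsBoxTP2.map_finRestrict [Lattice X] [BoundedOrder X] [MeasurableSpace X] {μ : Measure (ℕ → X)}
    (hμ : IsBoxTP2 μ) (d : ℕ) (hIcc : ∀ a b : Fin d → X, MeasurableSet (Icc a b)) :
    IsBoxTP2 (μ.map (finRestrict d)) := by
  intro a b a' b'
  simp only [Measure.map_apply (measurable_finRestrict d) (hIcc _ _), finRestrict_preimage_Icc, finExtend_inf,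
    finExtend_sup]
  exact hμ (finExtend d a ⊥) (finExtend d b ⊤) (finExtend d a' ⊥) (finExtend d b' ⊤)

end FinRestrict

/-! ### Box-TP₂ on `ℕ → X` is a condition on the finite-dimensional marginals -/

section Criterion

variable {X : Type*}

/-- A box of `ℕ → X` is the intersection of the cylinders over its initial-segment faces. [folklore] -/
theorem Icc_eq_iInter_finRestrict [Preorder X] (a b : ℕ → X) :
    Icc a b = ⋂ d, finRestrict d ⁻¹' Icc (finRestrict d a) (finRestrict d b) := by
  ext u
  simp only [mem_Icc, mem_iInter, mem_preimage, Pi.le_def, finRestrict_apply]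
  constructor
  · rintro ⟨h1, h2⟩ d
    exact ⟨fun i => h1 i, fun i => h2 i⟩
  · intro h
    exact ⟨fun i => (h (i + 1)).1 ⟨i, i.lt_succ_self⟩, fun i => (h (i + 1)).2 ⟨i, i.lt_succ_self⟩⟩

/-- The cylinders over the initial-segment faces of a box decrease with the dimension. [folklore] -/
theorem antitone_finRestrict_preimage_Icc [Preorder X] (a b : ℕ → X) :
    Antitone fun d => finRestrict d ⁻¹' Icc (finRestrict d a) (finRestrict d b) := by
  intro d d' hdd' u hu
  simp only [mem_preimage, mem_Icc, Pi.le_def, finRestrict_apply] at hu ⊢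
  exact ⟨fun i => hu.1 ⟨i, lt_of_lt_of_le i.2 hdd'⟩, fun i => hu.2 ⟨i, lt_of_lt_of_le i.2 hdd'⟩⟩

/-- **The mass of a box is the limit of the masses of its finite-dimensional faces** (continuity from above).
[folklore] -/
theorem tendsto_map_finRestrict_Icc [Preorder X] [MeasurableSpace X] (μ : Measure (ℕ → X)) [IsFiniteMeasure μ]
    (hIcc : ∀ (d : ℕ) (a b : Fin d → X), MeasurableSet (Icc a b)) (a b : ℕ → X) :
    Tendsto (fun d => μ.map (finRestrict d) (Icc (finRestrict d a) (finRestrict d b))) atTop (𝓝 (μ (Icc a b))) := by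
  have h := tendsto_measure_iInter_atTop (μ := μ)
    (fun d => ((hIcc d _ _).preimage (measurable_finRestrict d)).nullMeasurableSet)
    (antitone_finRestrict_preimage_Icc a b) ⟨0, measure_ne_top μ _⟩
  rw [← Icc_eq_iInter_finRestrict] at h
  refine h.congr fun d => ?_
  rw [Function.comp_apply, Measure.map_apply (measurable_finRestrict d) (hIcc d _ _)]

/-- **Box-TP₂ on `ℕ → X` ⟺ box-TP₂ of every initial-segment marginal** ("all finite-dimensional distributions
are box-TP₂"; `⇐` by continuity from above). [this work] -/
theorem isBoxTP2_iff_forall_map_finRestrict [Lattice X] [BoundedOrder X] [MeasurableSpace X]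
    {μ : Measure (ℕ → X)} [IsFiniteMeasure μ] (hIcc : ∀ (d : ℕ) (a b : Fin d → X), MeasurableSet (Icc a b)) :
    IsBoxTP2 μ ↔ ∀ d, IsBoxTP2 (μ.map (finRestrict d)) := by
  refine ⟨fun hμ d => hμ.map_finRestrict d (hIcc d), fun h a b a' b' => ?_⟩
  have hfin : ∀ s : Set (ℕ → X), μ s ≠ ∞ := fun s => measure_ne_top μ s
  refine le_of_tendsto_of_tendsto'
    (ENNReal.Tendsto.mul (tendsto_map_finRestrict_Icc μ hIcc a b) (Or.inr (hfin _))
      (tendsto_map_finRestrict_Icc μ hIcc a' b') (Or.inr (hfin _)))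
    (ENNReal.Tendsto.mul (tendsto_map_finRestrict_Icc μ hIcc (a ⊓ a') (b ⊓ b')) (Or.inr (hfin _))
      (tendsto_map_finRestrict_Icc μ hIcc (a ⊔ a') (b ⊔ b')) (Or.inr (hfin _))) fun d => ?_
  exact h d (finRestrict d a) (finRestrict d b) (finRestrict d a') (finRestrict d b')

/-- The unit-interval case: box-TP₂ on the Hilbert cube ⟺ every finite-dimensional marginal is box-TP₂ on `Q_d`.
[this work] -/
theorem isBoxTP2_iff_forall_map_finRestrict_unitInterval {μ : Measure (ℕ → I)} [IsFiniteMeasure μ] :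
    IsBoxTP2 μ ↔ ∀ d, IsBoxTP2 (μ.map (finRestrict d)) :=
  isBoxTP2_iff_forall_map_finRestrict fun _ _ _ => measurableSet_Icc

end Criterion

/-! ### The unit-interval case: marginals and the split of the last coordinate -/

section Hilbert

/-- `initLast (u_0,…,u_d) = ((u_0,…,u_{d-1}), u_d)`. [folklore] -/
theorem initLast_finRestrict_succ (d : ℕ) (u : ℕ → I) :
    initLast (finRestrict (d + 1) u) = (finRestrict d u, u d) := by
  refine Prod.ext ?_ rfl
  change Fin.removeNth (Fin.last d) (finRestrict (d + 1) u) = finRestrict d u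
  rw [Fin.removeNth_last]
  rfl

variable (μ : Measure (ℕ → I))

/-- Marginals of a probability measure are probability measures (instance for `finRestrict`). [folklore] -/
instance instIsProbabilityMeasureMapFinRestrict [IsProbabilityMeasure μ] (d : ℕ) :
    IsProbabilityMeasure (μ.map (finRestrict d)) :=
  Measure.isProbabilityMeasure_map (measurable_finRestrict d).aemeasurable

/-- **Consistency of the marginals**: the first `d` coordinates of the `(d+1)`-marginal form the `d`-marginal.
[folklore] -/
theorem fst_map_initLast_map_finRestrict_succ (d : ℕ) :
    ((μ.map (finRestrict (d + 1))).map initLast).fst = μ.map (finRestrict d) := by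
  rw [Measure.fst, Measure.map_map measurable_fst measurable_initLast,
    Measure.map_map (measurable_fst.comp measurable_initLast) (measurable_finRestrict _)]
  congr 1
  funext u
  simp only [Function.comp_apply, initLast_finRestrict_succ]

/-- Box-TP₂ marginals on `Q_d` (boxes of `Q_d` are measurable). [this work] -/
theorem IsBoxTP2.map_finRestrict_unitInterval {μ : Measure (ℕ → I)} (hμ : IsBoxTP2 μ) (d : ℕ) :
    IsBoxTP2 (μ.map (finRestrict d)) :=
  hμ.map_finRestrict d fun _ _ => measurableSet_Icc

end Hilbert

/-! ### Measures on `ℕ → X` are determined by their initial-segment marginals -/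

section Marginals

variable {X : Type*}

/-- Restriction of a `d`-tuple to a finite set of indices below `d`. -/
def finsetOfFin (J : Finset ℕ) (d : ℕ) (hJ : ∀ j ∈ J, j < d) (x : Fin d → X) : (j : J) → X :=
  fun j => x ⟨j, hJ j j.2⟩

/-- `J.restrict = finsetOfFin J d ∘ finRestrict d` when `J ⊆ {0,…,d-1}`. [folklore] -/
theorem restrict_eq_finsetOfFin_comp (J : Finset ℕ) (d : ℕ) (hJ : ∀ j ∈ J, j < d) :
    (J.restrict : (ℕ → X) → (j : J) → X) = finsetOfFin J d hJ ∘ finRestrict d := by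
  funext u j; rfl

variable [MeasurableSpace X]

/-- `finsetOfFin` is measurable. [folklore] -/
theorem measurable_finsetOfFin (J : Finset ℕ) (d : ℕ) (hJ : ∀ j ∈ J, j < d) :
    Measurable (finsetOfFin (X := X) J d hJ) :=
  measurable_pi_lambda _ fun j => measurable_pi_apply (⟨j, hJ j j.2⟩ : Fin d)

/-- **Two finite measures on `ℕ → X` with the same initial-segment marginals are equal** (both are projective
limits of the same family of finite-dimensional marginals). [folklore] -/
theorem ext_of_map_finRestrict {μ ν : Measure (ℕ → X)} [IsFiniteMeasure μ] [IsFiniteMeasure ν]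
    (h : ∀ d, μ.map (finRestrict d) = ν.map (finRestrict d)) : μ = ν := by
  have hμ : IsProjectiveLimit μ (fun J : Finset ℕ => μ.map J.restrict) := fun J => rfl
  have hν : IsProjectiveLimit ν (fun J : Finset ℕ => μ.map J.restrict) := by
    intro J
    set d := J.sup id + 1 with hd
    have hJ : ∀ j ∈ J, j < d := fun j hj => Nat.lt_succ_of_le (Finset.le_sup (f := id) hj)
    show ν.map J.restrict = μ.map J.restrict
    rw [restrict_eq_finsetOfFin_comp J d hJ,
      ← Measure.map_map (measurable_finsetOfFin J d hJ) (measurable_finRestrict d),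
      ← Measure.map_map (measurable_finsetOfFin J d hJ) (measurable_finRestrict d), h d]
  exact hμ.unique hν

/-- **The initial-segment marginals of `λ^ℕ` are the Lebesgue measures `λ_d`.** [folklore] -/
theorem infinitePi_map_finRestrict (ν : Measure X) [IsProbabilityMeasure ν] (d : ℕ) :
    (Measure.infinitePi (fun _ : ℕ => ν)).map (finRestrict d) = Measure.pi (fun _ : Fin d => ν) := by
  refine (Measure.pi_eq fun t ht => ?_).symm
  rw [Measure.map_apply (measurable_finRestrict d) (MeasurableSet.univ_pi ht)]
  have hset : finRestrict d ⁻¹' Set.pi univ t =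
      Set.pi (Finset.range d : Set ℕ) (fun i => if h : i < d then t ⟨i, h⟩ else univ) := by
    ext u
    simp only [mem_preimage, Set.mem_pi, mem_univ, true_implies, Finset.coe_range, mem_Iio]
    constructor
    · intro hu i hi
      simp only [dif_pos hi]; exact hu ⟨i, hi⟩
    · intro hu i
      have := hu i i.2
      simp only [dif_pos i.2] at this
      exact this
  rw [hset, Measure.infinitePi_pi]
  · rw [← Fin.prod_univ_eq_prod_range (fun i => ν (if h : i < d then t ⟨i, h⟩ else univ)) d]
    exact Finset.prod_congr rfl fun i _ => by rw [dif_pos i.2]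
  · intro i hi
    rw [Finset.mem_range] at hi
    rw [dif_pos hi]; exact ht _

end Marginals


/-! ### Lebesgue measure on the Hilbert cube -/

section Lebesgue

/-- Lebesgue measure on the Hilbert cube `ℕ → [0,1]`: the product of uniform laws. -/
abbrev lebesgueHilbert : Measure (ℕ → I) := Measure.infinitePi (fun _ : ℕ => (volume : Measure I))

/-- The `d`-marginal of `λ^ℕ` is `λ_d`. [folklore] -/
theorem lebesgueHilbert_map_finRestrict (d : ℕ) :
    lebesgueHilbert.map (finRestrict d) = (volume : Measure (Fin d → I)) :=
  infinitePi_map_finRestrict _ d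

end Lebesgue

end Summit.CriticalPhenomena.PercolationContinuityZ3.Theorems.SahiBoxTP2
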